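import Literature.Algebra.InverseSystem.DirectedSystemLifting
import Mathlib.Algebra.Group.Subgroup.Lattice
import Mathlib.Algebra.BigOperators.Group.Finset.Basic
import Mathlib.LinearAlgebra.Quotient.Basic
import HarnessLib

/-!
# Coinvariants commute with inverse limits of FINITE abelian groups over a directed index set (carrier-free): for a finite family of
# endomorphisms `D_q` of the system, (i) every compatible family lying levelwise in `Σ_q D_q(A_i)` IS `Σ_q D_q(c_q)` for COMPATIBLE families `c_q`;
# (ii) every compatible family of classes in `A_i / Σ_q D_q(A_i)` lifts to a compatible family of `A` — i.e.
# `(lim← A_i)/Σ_q D_q(lim← A_i) ≅ lim← (A_i/Σ_q D_q(A_i))` (Atiyah–Macdonald Prop. 10.2 / Weibel 3.5.7, `H₀`-form)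

Topic `Algebra/InverseSystem`; namespace `Literature.Algebra.InverseSystem`; currency of `DirectedSystemLifting.lean` (directed preorder `ι`, groups
`A i`, transitions `TA h : A j →+ A i` for `h : i ≤ j`, composable; families `a : Π i, A i`, compatibility `TA h (a j) = a i`; NO limit object is
formed).  Corollaries of the tree's lifting lemma `exists_compatible_preimage_of_finite` applied (i) to the map of systems
`(Q → A i) → A i`, `c ↦ Σ_q D_q c_q`, and (ii) to the quotient maps `A i → A i ⧸ R i`; plus the `ℤ`-module (`Submodule ℤ`) forms used by the
consumers.  THEOREMS ONLY (no definition, no named fact, no `sorry`).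

WHY (cell `bsd-print-cf2`, brick §4(c)/(e) dictionary D5, memo BRICK-C-SHAPIRO-g21 §3 (1)).  The pinned datum `U_∞/𝒞_∞` of the two-variable main
conjecture (`SemilocalUnitData₂`, ty2) is the inverse limit of FINITE layers `T(n,k) = U(F_n)/((𝒞∩U)·U^{(k+1)})`, and its `χ`-coinvariants
`M/⟨υm − χ(υ)m⟩` (`SemilocalUnitData₂.Coinv χ`; `υ` running through a finite quotient `G_tor` of `Υ`) are what LTYZ Thm 7.2 / the crux computes.
Shapiro's lemma (`InducedModuleTwistedCoinvariants`, `SemiLocalUnitGroupPlaceSummands`) reads the `χ`-coinvariants of each FINITE layer on ONE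
place; THIS file is the passage to the limit: with `D_q := act(q) − χ(q)` (`q` in a finite set of generators/representatives),
(ii) says `M_χ → lim← T(n,k)_χ` is onto and (i) says it is injective (an element of `M` which is a `χ`-relation at every level is a
`χ`-relation of COMPATIBLE families).  Pure algebra; the instantiation on ty2's `(n,k)`-system is left to the assembler.

* §1 `mem_iSup_range_iff_exists_sum` — `a ∈ ⨆_q range D_q ↔ a = Σ_q D_q c_q` (finite `Q`, commutative group); `sumMap D i : (Q → A i) →+ A i`.
* §2 ★★ **`exists_compatible_sum_eq_of_forall_mem`** — (i): `A i` finite, `D_q` commuting with the transitions, `a` compatible with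
  `a i ∈ ⨆_q range (D_q i)` for all `i` ⟹ `∃ c : Q → Π i, A i`, each `c q` compatible, `a i = Σ_q D_q i (c q i)`.
* §3 ★★ **`exists_compatible_lift_quotient`** — (ii): for ANY subgroups `R i` with `TA h (R j) ⊆ R i`, every compatible family of `A i ⧸ R i`
  lifts to a compatible family of `A` (`A i` finite); `exists_compatible_lift_mkQ` — the same for `ℤ`-submodules (`Submodule.mkQ`).
* §4 ★ `exists_compatible_sum_eq_of_forall_mem_span` — (i) in `Submodule ℤ`-currency: `a i ∈ span ℤ {D_q i x}` levelwise ⟹ `a = Σ_q D_q c_q`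
  with compatible `c_q` (the shape of `twistRel` / `SemilocalUnitData₂.coinvRel` with finitely many group elements).

## References
* M. F. Atiyah, I. G. Macdonald, *Introduction to Commutative Algebra* (1969), Ch. 10, Prop. 10.2, pp. 103–104. [AtiyahMacdonald1969]
* C. A. Weibel, *An introduction to homological algebra* (1994), §3.5, Prop. 3.5.7 (towers of finite groups are Mittag-Leffler). [Weibel1994]
-/

namespace Literature.Algebra.InverseSystem

universe u v

open Function

/-! ## §1. `⨆_q range D_q` is the set of finite sums `Σ_q D_q c_q` -/

section SumMap

variable {A : Type v} [AddCommGroup A] {Q : Type*} [Fintype Q] (D : Q → A →+ A)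

/-- **`sumMap D : (Q → A) →+ A`, `c ↦ Σ_q D_q c_q`.** [cite: AtiyahMacdonald1969, Ch. 10, pp. 103–104] -/
def sumMap : (Q → A) →+ A := ∑ q : Q, (D q).comp (Pi.evalAddMonoidHom (fun _ : Q => A) q)

/-- `sumMap D c = Σ_q D_q (c q)`. [cite: AtiyahMacdonald1969, Ch. 10, pp. 103–104] -/
theorem sumMap_apply (c : Q → A) : sumMap D c = ∑ q : Q, D q (c q) := by
  rw [sumMap, AddMonoidHom.finsetSum_apply]
  rfl

/-- **`a ∈ ⨆_q range D_q ↔ a = Σ_q D_q c_q` for some `c`** (finite index set, commutative group). [cite: AtiyahMacdonald1969, Ch. 10, pp. 103–104] -/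
theorem mem_iSup_range_iff_exists_sum (a : A) : a ∈ ⨆ q, (D q).range ↔ ∃ c : Q → A, a = ∑ q : Q, D q (c q) := by
  classical
  constructor
  · intro ha
    refine AddSubgroup.iSup_induction (fun q => (D q).range) (C := fun a => ∃ c : Q → A, a = ∑ q : Q, D q (c q)) ha ?_ ?_ ?_
    · rintro q _ ⟨x, rfl⟩
      refine ⟨Pi.single q x, ?_⟩
      rw [Finset.sum_eq_single q (fun q' _ hq' => by rw [Pi.single_eq_of_ne hq', map_zero]) (fun h => absurd (Finset.mem_univ q) h),
        Pi.single_eq_same]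
    · exact ⟨0, by simp⟩
    · rintro x y ⟨c, rfl⟩ ⟨c', rfl⟩
      exact ⟨c + c', by rw [← Finset.sum_add_distrib]; exact Finset.sum_congr rfl fun q _ => by rw [Pi.add_apply, map_add]⟩
  · rintro ⟨c, rfl⟩
    exact sum_mem fun q _ => AddSubgroup.mem_iSup_of_mem q ⟨c q, rfl⟩

/-- `range (sumMap D) = ⨆_q range D_q`. [cite: AtiyahMacdonald1969, Ch. 10, pp. 103–104] -/
theorem mem_range_sumMap_iff (a : A) : a ∈ (sumMap D).range ↔ a ∈ ⨆ q, (D q).range := by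
  rw [mem_iSup_range_iff_exists_sum]
  constructor
  · rintro ⟨c, rfl⟩
    exact ⟨c, sumMap_apply D c⟩
  · rintro ⟨c, rfl⟩
    exact ⟨c, sumMap_apply D c⟩

end SumMap

/-! ## §2. (i) A compatible family of relations is a relation of compatible families -/

section Directed

variable {ι : Type u} [Preorder ι] [IsDirectedOrder ι]
  {A : ι → Type v} [∀ i, AddCommGroup (A i)] {TA : ∀ ⦃i j : ι⦄, i ≤ j → A j →+ A i}
  {Q : Type*} [Fintype Q] (D : Q → ∀ i, A i →+ A i)

/-- ★★ **(i) Coinvariant relations lift compatibly.**  Let `A` be an inverse system of FINITE abelian groups over a directed index set, `D_q`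
(`q ∈ Q`, finite) endomorphisms commuting with the transitions.  If a compatible family `a` lies levelwise in `Σ_q D_q(A_i)`, then
**`a = Σ_q D_q(c_q)` for COMPATIBLE families `c_q`** (apply the lifting lemma to `(Q → A_i) → A_i`, `c ↦ Σ_q D_q c_q`, whose kernels are finite).
[cite: AtiyahMacdonald1969, Ch. 10, Prop. 10.2] [cite: Weibel1994, §3.5 Prop. 3.5.7] -/
theorem exists_compatible_sum_eq_of_forall_mem (hA : ∀ i, Finite (A i))
    (hTA : ∀ ⦃i j k : ι⦄ (hij : i ≤ j) (hjk : j ≤ k) (x : A k), TA hij (TA hjk x) = TA (hij.trans hjk) x)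
    (hD : ∀ (q : Q) ⦃i j : ι⦄ (h : i ≤ j) (y : A j), TA h (D q j y) = D q i (TA h y))
    {a : ∀ i, A i} (ha : ∀ ⦃i j : ι⦄ (h : i ≤ j), TA h (a j) = a i) (haR : ∀ i, a i ∈ ⨆ q, (D q i).range) :
    ∃ c : Q → ∀ i, A i, (∀ (q : Q) ⦃i j : ι⦄ (h : i ≤ j), TA h (c q j) = c q i) ∧ ∀ i, a i = ∑ q : Q, D q i (c q i) := by
  -- the auxiliary system `A' i := Q → A i` with componentwise transitions, and the map `sumMap`
  have hfin : ∀ i, Finite (Q → A i) := fun i => by haveI := hA i; infer_instance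
  obtain ⟨c, hc, hcs⟩ := exists_compatible_preimage_of_finite (ι := ι) (A := fun i => Q → A i) (B := A)
    (TA := fun i j h => (TA h).compLeft Q) (TB := TA) (f := fun i => sumMap (fun q => D q i)) hfin
    (fun _ _ _ hij hjk x => funext fun q => hTA hij hjk (x q))
    (fun _ _ h y => by
      rw [sumMap_apply, sumMap_apply, map_sum]
      exact Finset.sum_congr rfl fun q _ => hD q h (y q))
    ha (fun i => (mem_range_sumMap_iff _ _).mpr (haR i))
  refine ⟨fun q i => c i q, fun q i j h => ?_, fun i => ?_⟩
  · exact congr_fun (hc h) q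
  · rw [← hcs i, sumMap_apply]

/-! ## §3. (ii) Compatible families of classes lift -/

/-- ★★ **(ii) Compatible classes lift to compatible elements.**  For subgroups `R i ≤ A i` carried into each other by the transitions (so that the
quotients `A i ⧸ R i` form a system), every compatible family of classes is the image of a compatible family of `A` (`A i` finite: the quotient
maps are onto with finite kernels). [cite: AtiyahMacdonald1969, Ch. 10, Prop. 10.2] [cite: Weibel1994, §3.5 Prop. 3.5.7] -/
theorem exists_compatible_lift_quotient (hA : ∀ i, Finite (A i))
    (hTA : ∀ ⦃i j k : ι⦄ (hij : i ≤ j) (hjk : j ≤ k) (x : A k), TA hij (TA hjk x) = TA (hij.trans hjk) x)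
    (R : ∀ i, AddSubgroup (A i)) (hR : ∀ ⦃i j : ι⦄ (h : i ≤ j), (R j).map (TA h) ≤ R i)
    (y : ∀ i, A i ⧸ R i)
    (hy : ∀ ⦃i j : ι⦄ (h : i ≤ j), QuotientAddGroup.map (R j) (R i) (TA h) (fun x hx => hR h ⟨x, hx, rfl⟩) (y j) = y i) :
    ∃ a : ∀ i, A i, (∀ ⦃i j : ι⦄ (h : i ≤ j), TA h (a j) = a i) ∧ ∀ i, (QuotientAddGroup.mk' (R i)) (a i) = y i :=
  exists_compatible_preimage_of_finite (ι := ι) (A := A) (B := fun i => A i ⧸ R i) (TA := TA)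
    (TB := fun _ _ h => QuotientAddGroup.map (R _) (R _) (TA h) (fun x hx => hR h ⟨x, hx, rfl⟩))
    (f := fun i => QuotientAddGroup.mk' (R i)) hA hTA (fun _ _ _ _ => rfl) hy
    (fun i => QuotientAddGroup.mk'_surjective (R i) (y i))

/-- The same for `ℤ`-submodules and `Submodule.mkQ` (the currency of `twistRel` / `coinvRel`). [cite: AtiyahMacdonald1969, Ch. 10, Prop. 10.2] -/
theorem exists_compatible_lift_mkQ (hA : ∀ i, Finite (A i))
    {TL : ∀ ⦃i j : ι⦄, i ≤ j → A j →ₗ[ℤ] A i}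
    (hTL : ∀ ⦃i j k : ι⦄ (hij : i ≤ j) (hjk : j ≤ k) (x : A k), TL hij (TL hjk x) = TL (hij.trans hjk) x)
    (R : ∀ i, Submodule ℤ (A i)) (hR : ∀ ⦃i j : ι⦄ (h : i ≤ j), (R j).map (TL h) ≤ R i)
    (y : ∀ i, A i ⧸ R i)
    (hy : ∀ ⦃i j : ι⦄ (h : i ≤ j), Submodule.mapQ (R j) (R i) (TL h) (fun x hx => hR h ⟨x, hx, rfl⟩) (y j) = y i) :
    ∃ a : ∀ i, A i, (∀ ⦃i j : ι⦄ (h : i ≤ j), TL h (a j) = a i) ∧ ∀ i, (R i).mkQ (a i) = y i :=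
  exists_compatible_preimage_of_finite (ι := ι) (A := A) (B := fun i => A i ⧸ R i) (TA := fun _ _ h => (TL h).toAddMonoidHom)
    (TB := fun _ _ h => (Submodule.mapQ (R _) (R _) (TL h) (fun x hx => hR h ⟨x, hx, rfl⟩)).toAddMonoidHom)
    (f := fun i => (R i).mkQ.toAddMonoidHom) hA hTL (fun _ _ _ _ => rfl) hy
    (fun i => Submodule.mkQ_surjective (R i) (y i))

/-! ## §4. (i) in `Submodule ℤ`-currency: relations `span ℤ {D_q x}` -/

omit [Fintype Q] in
/-- `span ℤ {x | ∃ q y, x = D_q y} = (⨆_q range D_q)` as sets of a commutative group (the `ℤ`-span of a union of subgroups is their join).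
[cite: AtiyahMacdonald1969, Ch. 10, pp. 103–104] -/
theorem mem_span_setOf_iff_mem_iSup_range {B : Type v} [AddCommGroup B] (E : Q → B →+ B) (b : B) :
    b ∈ Submodule.span ℤ {x | ∃ (q : Q) (y : B), x = E q y} ↔ b ∈ ⨆ q, (E q).range := by
  constructor
  · intro hb
    refine Submodule.span_induction (p := fun b _ => b ∈ ⨆ q, (E q).range) ?_ ?_ ?_ ?_ hb
    · rintro x ⟨q, y, rfl⟩
      exact AddSubgroup.mem_iSup_of_mem q ⟨y, rfl⟩
    · exact AddSubgroup.zero_mem _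
    · intro x y _ _ hx hy
      exact AddSubgroup.add_mem _ hx hy
    · intro n x _ hx
      exact AddSubgroup.zsmul_mem _ hx n
  · intro hb
    refine AddSubgroup.iSup_induction (fun q => (E q).range) (C := fun b => b ∈ Submodule.span ℤ {x | ∃ (q : Q) (y : B), x = E q y}) hb
      ?_ ?_ ?_
    · rintro q _ ⟨y, rfl⟩
      exact Submodule.subset_span ⟨q, y, rfl⟩
    · exact Submodule.zero_mem _
    · intro x y hx hy
      exact Submodule.add_mem _ hx hy

/-- ★ **(i) in the currency of `twistRel`**: `D_q` commuting with the transitions of a system of FINITE abelian groups; a compatible family with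
`a i ∈ span ℤ {D_q i y}` at every level is `Σ_q D_q(c_q)` for COMPATIBLE `c_q` — so the `χ`-coinvariants of the inverse limit inject into the inverse
limit of the `χ`-coinvariants (with §3: they are isomorphic). [cite: AtiyahMacdonald1969, Ch. 10, Prop. 10.2] [cite: Weibel1994, §3.5 Prop. 3.5.7] -/
theorem exists_compatible_sum_eq_of_forall_mem_span (hA : ∀ i, Finite (A i))
    (hTA : ∀ ⦃i j k : ι⦄ (hij : i ≤ j) (hjk : j ≤ k) (x : A k), TA hij (TA hjk x) = TA (hij.trans hjk) x)
    (hD : ∀ (q : Q) ⦃i j : ι⦄ (h : i ≤ j) (y : A j), TA h (D q j y) = D q i (TA h y))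
    {a : ∀ i, A i} (ha : ∀ ⦃i j : ι⦄ (h : i ≤ j), TA h (a j) = a i)
    (haR : ∀ i, a i ∈ Submodule.span ℤ {x | ∃ (q : Q) (y : A i), x = D q i y}) :
    ∃ c : Q → ∀ i, A i, (∀ (q : Q) ⦃i j : ι⦄ (h : i ≤ j), TA h (c q j) = c q i) ∧ ∀ i, a i = ∑ q : Q, D q i (c q i) :=
  exists_compatible_sum_eq_of_forall_mem D hA hTA hD ha fun i => (mem_span_setOf_iff_mem_iSup_range (fun q => D q i) (a i)).mp (haR i)

end Directed

end Literature.Algebra.InverseSystem
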